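import Literature.NumberTheory.Sieve.DrappeauTypeIReduction
import Literature.NumberTheory.Sieve.DrappeauTypeIReductionBoxes
import HarnessLib

/-!
# Drappeau's kernel `𝔲_R` against smooth variables, III: the `g_s`-part

Topic `Literature/NumberTheory/Sieve`; theorems only, everything PROVED.  Third file of the treatment of the
Type I sums of S. Drappeau, PLMS 114 (2017) §6.2 (arXiv:1504.05549, p. 22).  After `uR_natCast_mul_eq`
(`𝔲_R = g_s −` characters), the `g_s`-part of `∑_s |∑_{m⃗, n, window} 𝔲_R(ν (∏mᵢ) n c̄; s)|` is cut by
`sum_window_decomp` into `H^k` window-free main sums — each an instance of the divisor-function input (the body of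
`FouvryTenenbaum2021.DivisorAPTuple k θ`, Fouvry–Tenenbaum's Lemmas 4.12–4.13 in tuple form, taken as the
hypothesis `hFT` with explicit constants) — plus boundary sums, bounded trivially by
`|g_s(N; c ν̄)| ≤ 1_{s ∣ νN − c} + 1/φ(s)` summed over the moduli (a divisor count `Dv` plus `∑_s 1/φ(s)`):

* `abs_gAP_le_ite`, `dvd_of_natCast_eq_aRep`, `sum_abs_gAP_le` — the trivial bound summed over `s`;
* `sum_abs_gAPpart_le` — the `g_s`-part: `≤ H^k C L^{C₀} x_F^{1−δ} Φ + (kY/(νH) + ∏ 2Vᵢ)(Dv + Φ)`, `Φ = ∑_s φ(s)⁻¹`.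

## References

* S. Drappeau, Proc. London Math. Soc. (3) 114 (2017) 684–732, §6.2. [Drappeau2017]
* É. Fouvry, G. Tenenbaum, Trans. Amer. Math. Soc. 375 (2022), §1.1, Lemmas 4.12–4.13. [FouvryTenenbaum2021]
-/

open Finset Fintype Real
open scoped ArithmeticFunction.sigma Classical

noncomputable section

namespace Literature.NumberTheory.Sieve

namespace DrappeauTypeI

open Drappeau2017 FouvryTenenbaum2021

/-! ### The trivial bound for `g_s`, summed over the moduli -/

/-- `|g_s(N; a)| ≤ 1_{N ≡ a (s)} + 1/φ(s)`. [folklore] -/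
theorem abs_gAP_le_ite (s : ℕ) (a : ℤ) (N : ℕ) :
    |gAP s a N| ≤ (if (N : ZMod s) = (a : ZMod s) then (1 : ℝ) else 0) + ((Nat.totient s : ℝ))⁻¹ := by
  unfold gAP
  refine (abs_sub _ _).trans (add_le_add ?_ ?_)
  · split_ifs <;> simp
  · rw [abs_div, Nat.abs_cast, ← one_div]
    rcases Nat.eq_zero_or_pos (Nat.totient s) with h | h
    · simp [h]
    · apply div_le_div_of_nonneg_right _ (by exact_mod_cast h.le)
      split_ifs <;> simp

/-- If `N ≡ c ν̄ (mod s)` then `s ∣ ν N − c`. [folklore] -/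
theorem dvd_of_natCast_eq_aRep {s : ℕ} [NeZero s] {c : ℤ} {ν : ℕ} (hν : ν.Coprime s) {N : ℕ}
    (h : (N : ZMod s) = ((aRep s c ν : ℤ) : ZMod s)) : (s : ℤ) ∣ (ν * N : ℕ) - c := by
  rw [aRep_cast] at h
  have hνu : IsUnit (ν : ZMod s) := (ZMod.isUnit_iff_coprime ν s).2 hν
  have h2 : (((ν * N : ℕ) : ℤ) : ZMod s) = (c : ZMod s) := by
    push_cast
    rw [h]
    calc (ν : ZMod s) * ((c : ZMod s) * ((ν : ZMod s))⁻¹) = (c : ZMod s) * ((ν : ZMod s) * ((ν : ZMod s))⁻¹) := by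
          ring
      _ = (c : ZMod s) := by rw [ZMod.mul_inv_of_unit _ hνu, mul_one]
  rw [← ZMod.intCast_zmod_eq_zero_iff_dvd, Int.cast_sub, h2, sub_self]

/-- **Summing the trivial bound for `g_s` over the moduli**: for `N` with `ν N ≠ c` in size `≤ 2^{k+2} ν x`,
`∑_{s} |g_s(N; c ν̄)| ≤ #{s : s ∣ νN − c} + ∑_s 1/φ(s)`. [folklore] -/
theorem sum_abs_gAP_le (𝒮 : Finset ℕ) {c : ℤ} {ν : ℕ} (h𝒮 : ∀ s ∈ 𝒮, 1 ≤ s ∧ ν.Coprime s) (N : ℕ) {Dv : ℝ}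
    (hDv : ((𝒮.filter (fun s : ℕ => (s : ℤ) ∣ ((ν * N : ℕ) : ℤ) - c)).card : ℝ) ≤ Dv) :
    ∑ s ∈ 𝒮, |gAP s (aRep s c ν) N| ≤ Dv + ∑ s ∈ 𝒮, ((Nat.totient s : ℝ))⁻¹ := by
  calc ∑ s ∈ 𝒮, |gAP s (aRep s c ν) N|
      ≤ ∑ s ∈ 𝒮, ((if (N : ZMod s) = ((aRep s c ν : ℤ) : ZMod s) then (1 : ℝ) else 0) +
          ((Nat.totient s : ℝ))⁻¹) := Finset.sum_le_sum fun s _ => abs_gAP_le_ite s _ N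
    _ = ∑ s ∈ 𝒮, (if (N : ZMod s) = ((aRep s c ν : ℤ) : ZMod s) then (1 : ℝ) else 0) +
          ∑ s ∈ 𝒮, ((Nat.totient s : ℝ))⁻¹ := Finset.sum_add_distrib
    _ ≤ ((𝒮.filter (fun s : ℕ => (s : ℤ) ∣ ((ν * N : ℕ) : ℤ) - c)).card : ℝ) + ∑ s ∈ 𝒮, ((Nat.totient s : ℝ))⁻¹ := by
        gcongr
        rw [← Finset.sum_boole]
        refine Finset.sum_le_sum fun s hs => ?_
        haveI : NeZero s := ⟨by have := (h𝒮 s hs).1; omega⟩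
        by_cases h : (N : ZMod s) = ((aRep s c ν : ℤ) : ZMod s)
        · rw [if_pos h, if_pos (dvd_of_natCast_eq_aRep (h𝒮 s hs).2 h)]
        · rw [if_neg h]; split_ifs <;> simp
    _ ≤ _ := by gcongr

/-- **The `g_s`-part of the Type I sum** (cut into `H^k` main sub-boxes, each an instance of the divisor-function
input `hFT`, plus the boundary). [cite: Drappeau2017, §6.2] -/
theorem sum_abs_gAPpart_le {k : ℕ} {θ δ C₀ C : ℝ}
    (hFT : ∀ x : ℝ, 1 ≤ x → ∀ (M lo hi : Fin k → ℝ) (Ml lol hil : ℝ), Monotone M → (∀ i, M i ≤ Ml) →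
      (∀ i, x ^ (1 / 100 : ℝ) ≤ M i) → x ^ (1 / 100 : ℝ) ≤ Ml → (∏ i, M i) * Ml ≤ x →
      (∀ i, M i ≤ lo i) → (∀ i, hi i ≤ 2 * M i) → Ml ≤ lol → hil ≤ 2 * Ml →
      ∀ (s D : ℕ) (a : ℤ) (t : Fin k → ℤ) (tl : ℤ), 1 ≤ s → (s : ℝ) ≤ x ^ θ → 1 ≤ D →
      IsCoprime (s : ℤ) (a * D) → (∀ i, IsCoprime (t i) (D : ℤ)) → IsCoprime tl (D : ℤ) →
      |∑ m ∈ piFinset (fun i => apBox (lo i) (hi i) D (t i)), ∑ n ∈ apBox lol hil D tl,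
          gAP s a ((∏ i, m i) * n)| ≤ C * (D : ℝ) ^ C₀ * x ^ (1 - δ) / (Nat.totient s : ℝ))
    {xF : ℝ} (hxF : 1 ≤ xF) {V : Fin k → ℝ} (hVmono : Monotone V) {Vl : ℝ} (hVVl : ∀ i, V i ≤ Vl)
    (hV1 : ∀ i, xF ^ (1 / 100 : ℝ) ≤ V i) (hVl1 : xF ^ (1 / 100 : ℝ) ≤ Vl) (hprod : (∏ i, V i) * Vl ≤ xF)
    {L : ℕ} (hL : 1 ≤ L) {t : Fin k → ℤ} (ht : ∀ i, IsCoprime (t i) (L : ℤ)) {tl : ℤ}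
    (htl : IsCoprime tl (L : ℤ)) {c : ℤ} (hcVl : (|c| : ℝ) ≤ Vl) {ν : ℕ} (hν : 1 ≤ ν) {Y : ℝ} (hY : 0 ≤ Y)
    {H : ℕ} (hH : 1 ≤ H) (𝒮 : Finset ℕ)
    (h𝒮 : ∀ s ∈ 𝒮, 1 ≤ s ∧ s.Coprime L ∧ IsCoprime (s : ℤ) c ∧ (s : ℝ) ≤ xF ^ θ ∧ ν.Coprime s)
    {Dv : ℝ} (hDv : ∀ z : ℤ, z ≠ 0 → (|z| : ℝ) ≤ 2 ^ (k + 2) * ν * xF →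
      ((𝒮.filter (fun s : ℕ => (s : ℤ) ∣ z)).card : ℝ) ≤ Dv) :
    ∑ s ∈ 𝒮, |∑ m ∈ piFinset (fun i => apBox (V i) (2 * V i) L (t i)), ∑ n ∈ apBox Vl (2 * Vl) L tl,
        (if ((ν * ((∏ i, m i) * n) : ℕ) : ℝ) ≤ Y then gAP s (aRep s c ν) ((∏ i, m i) * n) else 0)| ≤
      (H : ℝ) ^ k * (C * (L : ℝ) ^ C₀ * xF ^ (1 - δ)) * ∑ s ∈ 𝒮, ((Nat.totient s : ℝ))⁻¹ +
        ((k : ℝ) * Y / (ν * H) + ∏ i, (2 * V i)) * (Dv + ∑ s ∈ 𝒮, ((Nat.totient s : ℝ))⁻¹) := by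
  have hxF0 : 0 < xF := by linarith
  have hx100 : 1 ≤ xF ^ (1 / 100 : ℝ) := Real.one_le_rpow hxF (by norm_num)
  have hV1' : ∀ i, 1 ≤ V i := fun i => hx100.trans (hV1 i)
  have hV0 : ∀ i, 0 < V i := fun i => lt_of_lt_of_le one_pos (hV1' i)
  have hVl1' : 1 ≤ Vl := hx100.trans hVl1
  have hν0 : 0 < ν := hν
  have hH0 : 0 < H := hH
  have hν' : (0 : ℝ) < ν := by exact_mod_cast hν0
  set cut : (Fin k → ℕ) → ℝ := fun τ => min (2 * Vl) (Y / (ν * ∏ i, subHi (V i) H (τ i))) with hcutdef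
  have hcut : ∀ τ, cut τ ≤ 2 * Vl := fun τ => min_le_left _ _
  set W : (Fin k → ℕ) → ℕ → Prop := fun m n => ((ν * ((∏ i, m i) * n) : ℕ) : ℝ) ≤ Y with hWdef
  -- the window holds on the main parts
  have hW : ∀ τ ∈ piFinset (fun _ : Fin k => Finset.range H),
      ∀ m ∈ piFinset (fun i => apBox (subLo (V i) H (τ i)) (subHi (V i) H (τ i)) L (t i)),
      ∀ n ∈ apBox Vl (cut τ) L tl, W m n := by
    intro τ _ m hm n hn
    simp only [hWdef]
    set Q : ℝ := ∏ i, subHi (V i) H (τ i) with hQ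
    have hQpos : 0 < Q := Finset.prod_pos fun i _ => subHi_pos (hV0 i) H (τ i)
    have hPQ : (∏ i, (m i : ℝ)) ≤ Q := by
      rw [hQ]
      refine Finset.prod_le_prod (fun i _ => Nat.cast_nonneg _) fun i _ => ?_
      have h := Fintype.mem_piFinset.1 hm i
      unfold apBox at h
      rw [Finset.mem_filter, Finset.mem_Ioc] at h
      exact le_trans (by exact_mod_cast h.1.2) (Nat.floor_le (subHi_pos (hV0 i) H (τ i)).le)
    unfold apBox at hn
    rw [Finset.mem_filter, Finset.mem_Ioc] at hn
    have hn1 : 1 ≤ n := by omega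
    have hcutpos : 0 < cut τ := by
      by_contra hneg
      push Not at hneg
      have : ⌊cut τ⌋₊ = 0 := Nat.floor_of_nonpos hneg
      omega
    have hnle : (n : ℝ) ≤ cut τ := le_trans (by exact_mod_cast hn.1.2) (Nat.floor_le hcutpos.le)
    have hnle' : (n : ℝ) ≤ Y / (ν * Q) := hnle.trans (min_le_right _ _)
    rw [le_div_iff₀ (mul_pos hν' hQpos)] at hnle'
    push_cast
    have hn0 : (0 : ℝ) ≤ n := Nat.cast_nonneg n
    have hP0 : 0 ≤ ∏ i, (m i : ℝ) := Finset.prod_nonneg fun i _ => Nat.cast_nonneg _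
    calc (ν : ℝ) * ((∏ i, (m i : ℝ)) * n) ≤ ν * (Q * n) := by gcongr
      _ = n * (ν * Q) := by ring
      _ ≤ Y := hnle'
  -- per-modulus decomposition
  have hdec : ∀ s ∈ 𝒮, |∑ m ∈ piFinset (fun i => apBox (V i) (2 * V i) L (t i)), ∑ n ∈ apBox Vl (2 * Vl) L tl,
        (if W m n then gAP s (aRep s c ν) ((∏ i, m i) * n) else 0)| ≤
      ∑ τ ∈ piFinset (fun _ : Fin k => Finset.range H), C * (L : ℝ) ^ C₀ * xF ^ (1 - δ) / (Nat.totient s : ℝ) +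
      ∑ τ ∈ piFinset (fun _ : Fin k => Finset.range H),
        ∑ m ∈ piFinset (fun i => apBox (subLo (V i) H (τ i)) (subHi (V i) H (τ i)) L (t i)),
          ∑ n ∈ (apBox Vl (2 * Vl) L tl).filter (fun n => ⌊cut τ⌋₊ < n ∧ W m n),
            |gAP s (aRep s c ν) ((∏ i, m i) * n)| := by
    intro s hs
    obtain ⟨hs1, hsL, hsc, hsx, hsν⟩ := h𝒮 s hs
    haveI : NeZero s := ⟨by omega⟩
    rw [sum_window_decomp (fun i => (hV0 i).le) Vl L t tl hH0 cut hcut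
      (fun m n => gAP s (aRep s c ν) ((∏ i, m i) * n)) W hW]
    refine (abs_add_le _ _).trans (add_le_add ?_ ?_)
    · refine (Finset.abs_sum_le_sum_abs _ _).trans (Finset.sum_le_sum fun τ hτ => ?_)
      have hτi : ∀ i, τ i < H := fun i => Finset.mem_range.1 (Fintype.mem_piFinset.1 hτ i)
      exact hFT xF hxF V (fun i => subLo (V i) H (τ i)) (fun i => subHi (V i) H (τ i)) Vl Vl (cut τ)
        hVmono hVVl hV1 hVl1 hprod (fun i => le_subLo (hV0 i).le H (τ i))
        (fun i => subHi_le (hV0 i).le (hτi i)) le_rfl (hcut τ) s L (aRep s c ν) t tl hs1 hsx hL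
        ((isCoprime_aRep hsc hsν).mul_right (Nat.isCoprime_iff_coprime.2 hsL)) ht htl
    · refine (Finset.abs_sum_le_sum_abs _ _).trans (Finset.sum_le_sum fun τ _ => ?_)
      refine (Finset.abs_sum_le_sum_abs _ _).trans (Finset.sum_le_sum fun m _ => ?_)
      exact Finset.abs_sum_le_sum_abs _ _
  -- sum over the moduli
  calc _ ≤ ∑ s ∈ 𝒮, (∑ τ ∈ piFinset (fun _ : Fin k => Finset.range H),
          C * (L : ℝ) ^ C₀ * xF ^ (1 - δ) / (Nat.totient s : ℝ) +
        ∑ τ ∈ piFinset (fun _ : Fin k => Finset.range H),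
          ∑ m ∈ piFinset (fun i => apBox (subLo (V i) H (τ i)) (subHi (V i) H (τ i)) L (t i)),
            ∑ n ∈ (apBox Vl (2 * Vl) L tl).filter (fun n => ⌊cut τ⌋₊ < n ∧ W m n),
              |gAP s (aRep s c ν) ((∏ i, m i) * n)|) := Finset.sum_le_sum hdec
    _ = (H : ℝ) ^ k * (C * (L : ℝ) ^ C₀ * xF ^ (1 - δ)) * ∑ s ∈ 𝒮, ((Nat.totient s : ℝ))⁻¹ +
        ∑ τ ∈ piFinset (fun _ : Fin k => Finset.range H),
          ∑ m ∈ piFinset (fun i => apBox (subLo (V i) H (τ i)) (subHi (V i) H (τ i)) L (t i)),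
            ∑ n ∈ (apBox Vl (2 * Vl) L tl).filter (fun n => ⌊cut τ⌋₊ < n ∧ W m n),
              ∑ s ∈ 𝒮, |gAP s (aRep s c ν) ((∏ i, m i) * n)| := by
        rw [Finset.sum_add_distrib]
        congr 1
        · rw [Finset.mul_sum]
          refine Finset.sum_congr rfl fun s _ => ?_
          rw [Finset.sum_const, Fintype.card_piFinset_const, Finset.card_range, nsmul_eq_mul]
          push_cast
          ring
        · rw [Finset.sum_comm]
          refine Finset.sum_congr rfl fun τ _ => ?_
          rw [Finset.sum_comm]
          refine Finset.sum_congr rfl fun m _ => ?_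
          rw [Finset.sum_comm]
    _ ≤ (H : ℝ) ^ k * (C * (L : ℝ) ^ C₀ * xF ^ (1 - δ)) * ∑ s ∈ 𝒮, ((Nat.totient s : ℝ))⁻¹ +
        ∑ τ ∈ piFinset (fun _ : Fin k => Finset.range H),
          ∑ m ∈ piFinset (fun i => apBox (subLo (V i) H (τ i)) (subHi (V i) H (τ i)) L (t i)),
            ∑ _n ∈ (apBox Vl (2 * Vl) L tl).filter (fun n => ⌊cut τ⌋₊ < n ∧ W m n),
              (Dv + ∑ s ∈ 𝒮, ((Nat.totient s : ℝ))⁻¹) := by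
        gcongr with τ hτ m hm n hn
        refine sum_abs_gAP_le 𝒮 (fun s hs => ⟨(h𝒮 s hs).1, (h𝒮 s hs).2.2.2.2⟩) _ (hDv _ ?_ ?_)
        · -- `ν (∏ m) n − c ≠ 0`: indeed `(∏ m) n ≥ n > Vl ≥ |c|`
          rw [Finset.mem_filter] at hn
          unfold apBox at hn
          rw [Finset.mem_filter, Finset.mem_Ioc] at hn
          have hnVl : Vl < n := lt_of_lt_of_le (Nat.lt_floor_add_one Vl) (by exact_mod_cast hn.1.1.1)
          have hP1 : 1 ≤ ∏ i, m i := by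
            refine Finset.one_le_prod' fun i _ => ?_
            have h := Fintype.mem_piFinset.1 hm i
            unfold apBox at h
            rw [Finset.mem_filter, Finset.mem_Ioc] at h
            omega
          have hbig : (|c| : ℝ) < ((ν * ((∏ i, m i) * n) : ℕ) : ℝ) := by
            have h1 : (n : ℝ) ≤ ((ν * ((∏ i, m i) * n) : ℕ) : ℝ) := by
              exact_mod_cast (Nat.le_mul_of_pos_left n (Nat.mul_pos hν0 hP1)).trans (le_of_eq (by ring))
            linarith
          intro hz
          rw [sub_eq_zero] at hz
          have : ((ν * ((∏ i, m i) * n) : ℕ) : ℝ) = (c : ℝ) := by exact_mod_cast hz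
          rw [this] at hbig
          have := le_abs_self (c : ℝ)
          linarith
        · -- size
          rw [Finset.mem_filter] at hn
          unfold apBox at hn
          rw [Finset.mem_filter, Finset.mem_Ioc] at hn
          have hnle : (n : ℝ) ≤ 2 * Vl := le_trans (by exact_mod_cast hn.1.1.2) (Nat.floor_le (by linarith))
          have hPle : ((∏ i, m i : ℕ) : ℝ) ≤ ∏ i, (2 * V i) := by
            push_cast
            refine Finset.prod_le_prod (fun i _ => Nat.cast_nonneg _) fun i _ => ?_
            have h := Fintype.mem_piFinset.1 hm i
            unfold apBox at h
            rw [Finset.mem_filter, Finset.mem_Ioc] at h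
            have hτi : τ i < H := Finset.mem_range.1 (Fintype.mem_piFinset.1 hτ i)
            exact le_trans (by exact_mod_cast h.1.2)
              ((Nat.floor_le (subHi_pos (hV0 i) H (τ i)).le).trans (subHi_le (hV0 i).le hτi))
          have hprod2 : ∏ i, (2 * V i) = 2 ^ k * ∏ i, V i := by
            rw [Finset.prod_mul_distrib, Finset.prod_const, Finset.card_univ, Fintype.card_fin]
          have hVprod : 1 ≤ ∏ i, V i := Finset.one_le_prod (fun i _ => hV1' i)
          have hVl_le : Vl ≤ xF := by nlinarith
          have hN : (ν : ℝ) * ((∏ i, (m i : ℝ)) * n) ≤ 2 ^ (k + 1) * ν * xF := by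
            have hPle' : (∏ i, (m i : ℝ)) ≤ ∏ i, (2 * V i) := by push_cast at hPle; exact hPle
            have h1 : (∏ i, (m i : ℝ)) * n ≤ (2 ^ k * ∏ i, V i) * (2 * Vl) := by
              rw [← hprod2]
              exact mul_le_mul hPle' hnle (Nat.cast_nonneg _) (by rw [hprod2]; positivity)
            calc (ν : ℝ) * ((∏ i, (m i : ℝ)) * n) ≤ ν * ((2 ^ k * ∏ i, V i) * (2 * Vl)) :=
                  mul_le_mul_of_nonneg_left h1 hν'.le
              _ = 2 ^ (k + 1) * ν * ((∏ i, V i) * Vl) := by ring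
              _ ≤ 2 ^ (k + 1) * ν * xF := by gcongr
          have h0 : (0 : ℝ) ≤ (ν : ℝ) * ((∏ i, (m i : ℝ)) * n) := by positivity
          have hcx : |(c : ℝ)| ≤ xF := hcVl.trans hVl_le
          have hc1 : (c : ℝ) ≤ |(c : ℝ)| := le_abs_self _
          have hc2 : -(c : ℝ) ≤ |(c : ℝ)| := neg_le_abs _
          have hxF2 : xF ≤ 2 ^ (k + 1) * ν * xF := by
            have : (1 : ℝ) ≤ 2 ^ (k + 1) * ν :=
              one_le_mul_of_one_le_of_one_le (one_le_pow₀ (by norm_num)) (by exact_mod_cast hν)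
            nlinarith
          have h22 : (2 : ℝ) ^ (k + 2) * ν * xF = 2 * (2 ^ (k + 1) * ν * xF) := by ring
          rw [abs_le]
          constructor
          · push_cast
            linarith
          · push_cast
            linarith
    _ ≤ _ := by
        gcongr
        rw [show ∑ τ ∈ piFinset (fun _ : Fin k => Finset.range H),
          ∑ m ∈ piFinset (fun i => apBox (subLo (V i) H (τ i)) (subHi (V i) H (τ i)) L (t i)),
            ∑ _n ∈ (apBox Vl (2 * Vl) L tl).filter (fun n => ⌊cut τ⌋₊ < n ∧ W m n),
              (Dv + ∑ s ∈ 𝒮, ((Nat.totient s : ℝ))⁻¹) =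
          (∑ τ ∈ piFinset (fun _ : Fin k => Finset.range H),
            ∑ m ∈ piFinset (fun i => apBox (subLo (V i) H (τ i)) (subHi (V i) H (τ i)) L (t i)),
              ((((apBox Vl (2 * Vl) L tl).filter (fun n => ⌊cut τ⌋₊ < n ∧ W m n)).card : ℝ))) *
            (Dv + ∑ s ∈ 𝒮, ((Nat.totient s : ℝ))⁻¹) by
          rw [Finset.sum_mul]
          refine Finset.sum_congr rfl fun τ _ => ?_
          rw [Finset.sum_mul]
          refine Finset.sum_congr rfl fun m _ => ?_
          rw [Finset.sum_const, nsmul_eq_mul]]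
        have hDvpos : 0 ≤ Dv + ∑ s ∈ 𝒮, ((Nat.totient s : ℝ))⁻¹ := by
          have h1 : 0 ≤ Dv := le_trans (Nat.cast_nonneg _) (hDv 1 one_ne_zero (by
            simp only [Int.cast_one, abs_one]
            have h2 : (1 : ℝ) ≤ 2 ^ (k + 2) := one_le_pow₀ (by norm_num)
            have h3 : (1 : ℝ) ≤ ν := by exact_mod_cast hν
            have h4 : (1 : ℝ) ≤ 2 ^ (k + 2) * ν := one_le_mul_of_one_le_of_one_le h2 h3
            nlinarith))
          exact add_nonneg h1 (Finset.sum_nonneg fun _ _ => inv_nonneg.2 (Nat.cast_nonneg _))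
        refine mul_le_mul_of_nonneg_right ?_ hDvpos
        have := card_boundary_le hV1' hY hν0 hH0 L t tl (Vl := Vl)
        simpa only [hcutdef, hWdef] using this

end DrappeauTypeI

end Literature.NumberTheory.Sieve

end
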